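import Mathlib
import HarnessLib
import Summits.CriticalPhenomena.PercolationContinuityZ3.Theorems.PercNearOneGluingNoHeavyQuantFarDecRatioPair

/-!
# QUANT lane R8, front "FAR beyond trees", layer one — THE RATIO INEQUALITY (C) OF THE ONE-VERTEX DECOUPLING STEP,
# abstract-sum form, part 2: (V1), the boosted increment, (C1) for every boost, and (C)

builds on p205010 (kernel theorem, internal audit signed; external expert review pending)

Support file (`--supports stmt-CriticalPhenomena-4575`), seat `prim-quant-p1` (gen 21); memo
`run/shared/lean/prim/quant/prim-quant-p1-g21/FOR-LEAD-CYCDEC.md` §3–§4.  Standard axioms; no sorries; no definitions.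
Setting, notation and hypotheses exactly as in part 1 (`T/…QuantFarDecRatioPair`, module docstring).  This file proves:

* `ratio_V1` — `x_β·N₀·(1 − H) ≤ (1 − x_β)·Dn₀·T`, `x_β = (β + (1 − β)A_1)u_1 = m_1u_1` (the UNBOOSTED increment, boost
  `b = 0`): `(T1)` on the double sum with `x = A_1u_1`, the remainder is `β·(∗)`, `(∗) ⟸ A_1·(T2) + (1 − A_1)·(∗∗∗)`;
* `ratio_boost` — `x_β·(N₀ + β(D2all − T))·(1 − H) ≤ (1 − x_β)·(Dn₀ + β((1 − H) − Zall))·T` (boost `b = β`): product of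
  `(i) x_β(1−β)(1−H) ≤ (1−x_β)·Λ_β(U)` (`Λ_β(U) = Dn₀ + β·c̄ ≥ x_β·Σ_ρP_ρZq`, `1 − H ≤ βZall + (1 − x)Σ_ρP_ρZq`,
  `(1−β)Zall ≤ z_1Σ_ρP_ρZq`) and `(ii) Λ_β(T) = N₀ + β·ā ≤ (1−β)T`;
* `ratio_C1` — the same for every boost `b ∈ [0, β]` (both sides affine in `b`);
* `ratio_C` — with `x_β` replaced by any `q ≤ x_β` and an overall factor `κ ≥ 0`: this is hypothesis `(C)` of
  `Block.dominates_hubStep` (`T/…QuantFarDecStep`) with `σ = κ(Dn₀ + b·c̄)`, `π = κ(N₀ + b·ā)`, `κ = 1 − A_0`,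
  `c̄ = (1 − H) − Zall`, `ā = D2all − T` (memo §2–§3: in the k-anchor programme `q = min_i m_iu_i ≤ m_1u_1 = x_β`).
[this work]
-/

namespace Summit.CriticalPhenomena.PercolationContinuityZ3.Theorems

namespace Quant

namespace Block

open Finset

section Sums

variable {ι : Type*} (S : Finset ι) (P Zq Sq Dq g1 g2 ZF DF : ι → ℝ)
variable (A1 u1 z1 β Zall D2all : ℝ)

/-- **(V1)** — the ratio inequality for the UNBOOSTED increment with the boosted exit bound:
`x_β·N₀·(1 − H) ≤ (1 − x_β)·Dn₀·T`, `x_β = (β + (1 − β)A₁)u₁ (= m₁u₁)` (memo §4).  Proof: `(T1)` on the double sum with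
`x = A₁u₁`, then the remainder is `β·(∗)` with `(∗) ⟸ A₁·(T2) + (1 − A₁)·(∗∗∗)`. [this work] -/
theorem ratio_V1
    (hP : ∀ ρ ∈ S, 0 ≤ P ρ) (hsum : ∑ ρ ∈ S, P ρ = 1 - β) (hβ0 : 0 ≤ β)
    (hA0 : 0 ≤ A1) (hA1 : A1 ≤ 1) (hu0 : 0 ≤ u1) (hu1 : u1 ≤ 1) (huz : u1 + z1 = 1)
    (hZq : ∀ ρ ∈ S, 0 ≤ Zq ρ) (hSq : ∀ ρ ∈ S, 0 ≤ Sq ρ) (hDq : ∀ ρ ∈ S, 0 ≤ Dq ρ) (hg1 : ∀ ρ ∈ S, 0 ≤ g1 ρ)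
    (hg2nn : ∀ ρ ∈ S, 0 ≤ g2 ρ) (hZF : ∀ ρ ∈ S, 0 ≤ ZF ρ) (hDF : ∀ ρ ∈ S, 0 ≤ DF ρ)
    (hx : ∀ ρ ∈ S, A1 * u1 ≤ g1 ρ) (hgU : ∀ ρ ∈ S, g1 ρ ≤ A1 * (1 - ZF ρ)) (hg2 : ∀ ρ ∈ S, g2 ρ ≤ A1 * DF ρ)
    (hZFz : ∀ ρ ∈ S, ZF ρ ≤ z1) (hZall : ∀ ρ ∈ S, Zall = Zq ρ * ZF ρ)
    (hD : ∀ ρ ∈ S, D2all = Dq ρ + Sq ρ * (1 - ZF ρ) + Zq ρ * DF ρ) (N0 Dn0 omH T : ℝ)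
    (hN0 : N0 = ∑ ρ ∈ S, P ρ * (Zq ρ * g2 ρ + Sq ρ * g1 ρ)) (hDn0 : Dn0 = ∑ ρ ∈ S, P ρ * (Zq ρ * g1 ρ))
    (homH : omH = β * Zall + ∑ ρ ∈ S, P ρ * (Zq ρ * (1 - g1 ρ)))
    (hT : T = β * D2all + ∑ ρ ∈ S, P ρ * (Zq ρ * g2 ρ + Sq ρ * g1 ρ + Dq ρ)) :
    (β + (1 - β) * A1) * u1 * N0 * omH ≤ (1 - (β + (1 - β) * A1) * u1) * Dn0 * T := by
  classical
  set a : ι → ℝ := fun ρ => Zq ρ * g2 ρ + Sq ρ * g1 ρ with ha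
  set b : ι → ℝ := fun ρ => Zq ρ * (1 - g1 ρ) with hb
  set c : ι → ℝ := fun ρ => Zq ρ * g1 ρ with hc
  set d : ι → ℝ := fun ρ => Zq ρ * g2 ρ + Sq ρ * g1 ρ + Dq ρ with hd
  set As := ∑ ρ ∈ S, P ρ * a ρ with hAs
  set Bs := ∑ ρ ∈ S, P ρ * b ρ with hBs
  set Cs := ∑ ρ ∈ S, P ρ * c ρ with hCs
  set Ds := ∑ ρ ∈ S, P ρ * d ρ with hDs
  set x := A1 * u1 with hxdef
  have hx0 : 0 ≤ x := mul_nonneg hA0 hu0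
  have hN0' : N0 = As := by rw [hN0]
  have hDn0' : Dn0 = Cs := by rw [hDn0]
  have homH' : omH = β * Zall + Bs := by rw [homH]
  have hT' : T = β * D2all + Ds := by rw [hT]
  -- (***) in the abbreviated variables
  have h3 := ratio_threeStar S P Zq Sq Dq g1 g2 ZF DF A1 u1 z1 β Zall D2all hP hsum hβ0 hu0 hu1 huz hZq hSq hDq hg1
    hZF hDF hx hgU hg2 hZFz hZall hD N0 Dn0 omH T hN0 hDn0 homH hT
  rw [hN0', hDn0', homH', hT'] at h3
  -- (T2) summed: u1 As Zall ≤ z1 Cs D2all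
  have hT2 : u1 * As * Zall ≤ z1 * Cs * D2all := by
    have hpt : ∀ ρ ∈ S, P ρ * (u1 * a ρ * Zall) ≤ P ρ * (z1 * c ρ * D2all) := by
      intro ρ hρ
      apply mul_le_mul_of_nonneg_left _ (hP ρ hρ)
      have := ratio_T2 A1 u1 z1 Zall D2all (Zq ρ) (Sq ρ) (Dq ρ) (g1 ρ) (g2 ρ) (ZF ρ) (DF ρ) hu0 huz
        (hZq ρ hρ) (hSq ρ hρ) (hDq ρ hρ) (hg1 ρ hρ) (hZF ρ hρ) (hDF ρ hρ) (hx ρ hρ) (hg2 ρ hρ) (hZFz ρ hρ)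
        (hZall ρ hρ) (hD ρ hρ)
      simpa only [ha, hc] using this
    have hS := Finset.sum_le_sum hpt
    have e1 : ∑ ρ ∈ S, P ρ * (u1 * a ρ * Zall) = u1 * As * Zall := by
      rw [hAs, Finset.mul_sum, Finset.sum_mul]; apply Finset.sum_congr rfl; intro ρ _; ring
    have e2 : ∑ ρ ∈ S, P ρ * (z1 * c ρ * D2all) = z1 * Cs * D2all := by
      rw [hCs, Finset.mul_sum, Finset.sum_mul]; apply Finset.sum_congr rfl; intro ρ _; ring
    rw [e1, e2] at hS; exact hS
  -- (*): x As Zall + (1 - A1) u1 (As (βZall+Bs) + Cs (βD2all+Ds)) ≤ (1 - x) Cs D2all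
  have hstar : x * As * Zall + (1 - A1) * u1 * (As * (β * Zall + Bs) + Cs * (β * D2all + Ds))
      ≤ (1 - x) * Cs * D2all := by
    have p1 : x * As * Zall ≤ A1 * (z1 * Cs * D2all) := by
      have := mul_le_mul_of_nonneg_left hT2 hA0
      have e : A1 * (u1 * As * Zall) = x * As * Zall := by rw [hxdef]; ring
      linarith
    have p2 : (1 - A1) * u1 * (As * (β * Zall + Bs) + Cs * (β * D2all + Ds)) ≤ (1 - A1) * (Cs * D2all) := by
      have := mul_le_mul_of_nonneg_left h3 (sub_nonneg.mpr hA1)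
      have e : (1 - A1) * (u1 * (As * (β * Zall + Bs) + Cs * (β * D2all + Ds)))
          = (1 - A1) * u1 * (As * (β * Zall + Bs) + Cs * (β * D2all + Ds)) := by ring
      linarith
    have e : A1 * (z1 * Cs * D2all) + (1 - A1) * (Cs * D2all) = (1 - x) * Cs * D2all := by
      have hz : z1 = 1 - u1 := by linarith
      rw [hxdef, hz]; ring
    linarith
  -- (T1) on the double sum: x As Bs ≤ (1-x) Cs Ds
  have hT1 : x * As * Bs ≤ (1 - x) * Cs * Ds := by
    have hpt : ∀ ρ ∈ S, ∀ ρ' ∈ S, (P ρ * (x * a ρ)) * (P ρ' * b ρ') ≤ (P ρ * d ρ) * (P ρ' * ((1 - x) * c ρ')) := by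
      intro ρ hρ ρ' hρ'
      have hg1le : g1 ρ' ≤ 1 := by
        have h1 := hgU ρ' hρ'
        have h2 : A1 * (1 - ZF ρ') ≤ 1 := by nlinarith [hZF ρ' hρ', mul_nonneg hA0 (hZF ρ' hρ')]
        linarith
      have hT1' := ratio_T1 x (Zq ρ) (Sq ρ) (Dq ρ) (g1 ρ) (g2 ρ) (Zq ρ') (g1 ρ')
        (add_nonneg (mul_nonneg (hZq ρ hρ) (hg2nn ρ hρ)) (mul_nonneg (hSq ρ hρ) (hg1 ρ hρ))) (hDq ρ hρ) (hZq ρ' hρ')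
        hx0 (hx ρ' hρ') hg1le
      have hPP : 0 ≤ P ρ * P ρ' := mul_nonneg (hP ρ hρ) (hP ρ' hρ')
      have := mul_le_mul_of_nonneg_left hT1' hPP
      have e1 : (P ρ * (x * a ρ)) * (P ρ' * b ρ')
          = P ρ * P ρ' * (x * (Zq ρ * g2 ρ + Sq ρ * g1 ρ) * (Zq ρ' * (1 - g1 ρ'))) := by
        simp only [ha, hb]; ring
      have e2 : (P ρ * d ρ) * (P ρ' * ((1 - x) * c ρ'))
          = P ρ * P ρ' * ((1 - x) * (Zq ρ' * g1 ρ') * (Zq ρ * g2 ρ + Sq ρ * g1 ρ + Dq ρ)) := by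
        simp only [hc, hd]; ring
      rw [e1, e2]; exact this
    have hS : ∑ ρ ∈ S, ∑ ρ' ∈ S, (P ρ * (x * a ρ)) * (P ρ' * b ρ')
        ≤ ∑ ρ ∈ S, ∑ ρ' ∈ S, (P ρ * d ρ) * (P ρ' * ((1 - x) * c ρ')) :=
      Finset.sum_le_sum (fun ρ hρ => Finset.sum_le_sum (fun ρ' hρ' => hpt ρ hρ ρ' hρ'))
    have eL : x * As * Bs = ∑ ρ ∈ S, ∑ ρ' ∈ S, (P ρ * (x * a ρ)) * (P ρ' * b ρ') := by
      have e0 : x * As * Bs = x * (As * Bs) := by ring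
      rw [e0, hAs, hBs, Finset.sum_mul_sum, Finset.mul_sum]
      apply Finset.sum_congr rfl; intro ρ _
      rw [Finset.mul_sum]
      apply Finset.sum_congr rfl; intro ρ' _; ring
    have eR : (1 - x) * Cs * Ds = ∑ ρ ∈ S, ∑ ρ' ∈ S, (P ρ * d ρ) * (P ρ' * ((1 - x) * c ρ')) := by
      have e0 : (1 - x) * Cs * Ds = (1 - x) * (Ds * Cs) := by ring
      rw [e0, hDs, hCs, Finset.sum_mul_sum, Finset.mul_sum]
      apply Finset.sum_congr rfl; intro ρ _
      rw [Finset.mul_sum]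
      apply Finset.sum_congr rfl; intro ρ' _; ring
    rw [eL, eR]; exact hS
  -- final algebra
  rw [hN0', hDn0', homH', hT']
  have hfin : (β + (1 - β) * A1) * u1 * As * (β * Zall + Bs) - (1 - (β + (1 - β) * A1) * u1) * Cs * (β * D2all + Ds)
      = (x * As * Bs - (1 - x) * Cs * Ds)
        + β * (x * As * Zall + (1 - A1) * u1 * (As * (β * Zall + Bs) + Cs * (β * D2all + Ds)) - (1 - x) * Cs * D2all) := by
    rw [hxdef]; ring
  have hβneg : β * (x * As * Zall + (1 - A1) * u1 * (As * (β * Zall + Bs) + Cs * (β * D2all + Ds)) - (1 - x) * Cs * D2all) ≤ 0 :=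
    mul_nonpos_of_nonneg_of_nonpos hβ0 (by linarith)
  linarith [hfin, hT1, hβneg]

/-- **The boosted increment (`b = β`)** (memo §3): `x_β·(N₀ + β(D2all − T))·(1 − H) ≤ (1 − x_β)·(Dn₀ + β((1 − H) − Zall))·T`.
Product of `(i) x_β(1 − β)(1 − H) ≤ (1 − x_β)(Dn₀ + β((1−H) − Zall))` and `(ii) N₀ + β(D2all − T) ≤ (1 − β)T`. [this work] -/
theorem ratio_boost
    (hP : ∀ ρ ∈ S, 0 ≤ P ρ) (hsum : ∑ ρ ∈ S, P ρ = 1 - β) (hβ0 : 0 ≤ β) (hβ1 : β ≤ 1)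
    (hA0 : 0 ≤ A1) (hA1 : A1 ≤ 1) (hu0 : 0 ≤ u1) (hu1 : u1 ≤ 1) (huz : u1 + z1 = 1)
    (hZq : ∀ ρ ∈ S, 0 ≤ Zq ρ) (hSq : ∀ ρ ∈ S, 0 ≤ Sq ρ) (hDq : ∀ ρ ∈ S, 0 ≤ Dq ρ) (hg1 : ∀ ρ ∈ S, 0 ≤ g1 ρ)
    (hg1le : ∀ ρ ∈ S, g1 ρ ≤ 1) (hg2nn : ∀ ρ ∈ S, 0 ≤ g2 ρ)
    (hx : ∀ ρ ∈ S, A1 * u1 ≤ g1 ρ) (hZFz : ∀ ρ ∈ S, ZF ρ ≤ z1) (hZall : ∀ ρ ∈ S, Zall = Zq ρ * ZF ρ)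
    (hZall0 : 0 ≤ Zall) (hD0 : 0 ≤ D2all) (N0 Dn0 omH T : ℝ)
    (hN0 : N0 = ∑ ρ ∈ S, P ρ * (Zq ρ * g2 ρ + Sq ρ * g1 ρ)) (hDn0 : Dn0 = ∑ ρ ∈ S, P ρ * (Zq ρ * g1 ρ))
    (homH : omH = β * Zall + ∑ ρ ∈ S, P ρ * (Zq ρ * (1 - g1 ρ)))
    (hT : T = β * D2all + ∑ ρ ∈ S, P ρ * (Zq ρ * g2 ρ + Sq ρ * g1 ρ + Dq ρ)) :
    (β + (1 - β) * A1) * u1 * (N0 + β * (D2all - T)) * omH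
      ≤ (1 - (β + (1 - β) * A1) * u1) * (Dn0 + β * (omH - Zall)) * T := by
  classical
  set xβ := (β + (1 - β) * A1) * u1 with hxβ
  set x := A1 * u1 with hxdef
  set PE := ∑ ρ ∈ S, P ρ * Zq ρ with hPE
  have hz1 : z1 = 1 - u1 := by linarith
  have hPE0 : 0 ≤ PE := Finset.sum_nonneg (fun ρ hρ => mul_nonneg (hP ρ hρ) (hZq ρ hρ))
  -- (ii): N0 + β (D2all - T) ≤ (1-β) T, i.e. N0 + β D2all ≤ T
  have hii : N0 + β * (D2all - T) ≤ (1 - β) * T := by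
    have : N0 ≤ ∑ ρ ∈ S, P ρ * (Zq ρ * g2 ρ + Sq ρ * g1 ρ + Dq ρ) := by
      rw [hN0]; apply Finset.sum_le_sum; intro ρ hρ
      apply mul_le_mul_of_nonneg_left _ (hP ρ hρ); linarith [hDq ρ hρ]
    rw [hT]; linarith
  -- Step 3: (1-β) Zall ≤ z1 PE
  have hS3 : (1 - β) * Zall ≤ z1 * PE := by
    have hle : ∑ ρ ∈ S, P ρ * Zall ≤ ∑ ρ ∈ S, P ρ * (Zq ρ * z1) := by
      apply Finset.sum_le_sum; intro ρ hρ
      apply mul_le_mul_of_nonneg_left _ (hP ρ hρ)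
      rw [hZall ρ hρ]; exact mul_le_mul_of_nonneg_left (hZFz ρ hρ) (hZq ρ hρ)
    have l1 : ∑ ρ ∈ S, P ρ * Zall = (1 - β) * Zall := by rw [← Finset.sum_mul, hsum]
    have l2 : ∑ ρ ∈ S, P ρ * (Zq ρ * z1) = z1 * PE := by
      rw [hPE, Finset.mul_sum]; apply Finset.sum_congr rfl; intro ρ _; ring
    linarith
  -- Step 1: Dn0 + β(omH - Zall) ≥ xβ PE
  have hS1 : xβ * PE ≤ Dn0 + β * (omH - Zall) := by
    have e1 : Dn0 + β * (omH - Zall) = (∑ ρ ∈ S, P ρ * Zq ρ * (g1 ρ + β * (1 - g1 ρ))) - β * (1 - β) * Zall := by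
      rw [hDn0, homH]
      have : ∑ ρ ∈ S, P ρ * Zq ρ * (g1 ρ + β * (1 - g1 ρ))
          = ∑ ρ ∈ S, P ρ * (Zq ρ * g1 ρ) + β * ∑ ρ ∈ S, P ρ * (Zq ρ * (1 - g1 ρ)) := by
        rw [Finset.mul_sum, ← Finset.sum_add_distrib]; apply Finset.sum_congr rfl; intro ρ _; ring
      rw [this]; ring
    have e2 : ∑ ρ ∈ S, P ρ * Zq ρ * (β + (1 - β) * x) ≤ ∑ ρ ∈ S, P ρ * Zq ρ * (g1 ρ + β * (1 - g1 ρ)) := by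
      apply Finset.sum_le_sum; intro ρ hρ
      apply mul_le_mul_of_nonneg_left _ (mul_nonneg (hP ρ hρ) (hZq ρ hρ))
      have h1 := hx ρ hρ
      have h2 : (1 - β) * x ≤ (1 - β) * g1 ρ := mul_le_mul_of_nonneg_left h1 (by linarith)
      have e : g1 ρ + β * (1 - g1 ρ) = β + (1 - β) * g1 ρ := by ring
      linarith
    have e3 : ∑ ρ ∈ S, P ρ * Zq ρ * (β + (1 - β) * x) = (β + (1 - β) * x) * PE := by
      rw [hPE, Finset.mul_sum]; apply Finset.sum_congr rfl; intro ρ _; ring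
    have e5 : xβ * PE = (β + (1 - β) * x) * PE - β * (z1 * PE) := by rw [hxβ, hxdef, hz1]; ring
    rw [e1, e5]
    have := mul_le_mul_of_nonneg_left hS3 hβ0
    linarith
  -- Step 2: omH ≤ β Zall + (1 - x) PE
  have hS2 : omH ≤ β * Zall + (1 - x) * PE := by
    have hle : ∑ ρ ∈ S, P ρ * (Zq ρ * (1 - g1 ρ)) ≤ ∑ ρ ∈ S, (1 - x) * (P ρ * Zq ρ) := by
      apply Finset.sum_le_sum; intro ρ hρ
      have h1 : 1 - g1 ρ ≤ 1 - x := by linarith [hx ρ hρ]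
      have := mul_le_mul_of_nonneg_left h1 (mul_nonneg (hP ρ hρ) (hZq ρ hρ))
      have e1 : P ρ * Zq ρ * (1 - g1 ρ) = P ρ * (Zq ρ * (1 - g1 ρ)) := by ring
      have e2 : P ρ * Zq ρ * (1 - x) = (1 - x) * (P ρ * Zq ρ) := by ring
      linarith
    rw [homH, hPE, Finset.mul_sum]; linarith
  -- Step 4: (i)
  have hβA : 0 ≤ β + (1 - β) * A1 := add_nonneg hβ0 (mul_nonneg (by linarith) hA0)
  have hβA1 : β + (1 - β) * A1 ≤ 1 := by nlinarith [mul_nonneg (sub_nonneg.mpr hβ1) (sub_nonneg.mpr hA1)]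
  have hxβ0 : 0 ≤ xβ := by rw [hxβ]; exact mul_nonneg hβA hu0
  have hxβ1 : xβ ≤ 1 := by
    rw [hxβ]; have := mul_le_mul hβA1 hu1 hu0 (by linarith : (0:ℝ) ≤ 1); linarith
  have hi : xβ * (1 - β) * omH ≤ (1 - xβ) * (Dn0 + β * (omH - Zall)) := by
    have a1 : xβ * (1 - β) * omH ≤ xβ * (1 - β) * (β * Zall + (1 - x) * PE) :=
      mul_le_mul_of_nonneg_left hS2 (mul_nonneg hxβ0 (by linarith))
    have a2 : xβ * ((1 - β) * (β * Zall)) ≤ xβ * (β * (z1 * PE)) := by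
      apply mul_le_mul_of_nonneg_left _ hxβ0
      have := mul_le_mul_of_nonneg_left hS3 hβ0
      have e : β * ((1 - β) * Zall) = (1 - β) * (β * Zall) := by ring
      linarith
    have a3 : (1 - β) * (1 - x) + β * z1 = 1 - xβ := by rw [hxβ, hxdef, hz1]; ring
    have a4 : xβ * (((1 - β) * (1 - x) + β * z1) * PE) ≤ (1 - xβ) * (Dn0 + β * (omH - Zall)) := by
      rw [a3]
      have := mul_le_mul_of_nonneg_left hS1 (by linarith : (0:ℝ) ≤ 1 - xβ)
      have e : (1 - xβ) * (xβ * PE) = xβ * ((1 - xβ) * PE) := by ring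
      linarith
    have e1 : xβ * (1 - β) * (β * Zall + (1 - x) * PE) = xβ * ((1 - β) * (β * Zall)) + xβ * ((1 - β) * (1 - x) * PE) := by ring
    have e2 : xβ * (((1 - β) * (1 - x) + β * z1) * PE) = xβ * ((1 - β) * (1 - x) * PE) + xβ * (β * (z1 * PE)) := by ring
    linarith [a1, a2, a4]
  -- product (i) × (ii)
  have homH0 : 0 ≤ omH := by
    rw [homH]; apply add_nonneg (mul_nonneg hβ0 hZall0)
    exact Finset.sum_nonneg (fun ρ hρ => mul_nonneg (hP ρ hρ) (mul_nonneg (hZq ρ hρ) (by linarith [hg1le ρ hρ])))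
  have hT0' : 0 ≤ T := by
    rw [hT]; apply add_nonneg (mul_nonneg hβ0 hD0)
    exact Finset.sum_nonneg (fun ρ hρ => mul_nonneg (hP ρ hρ)
      (add_nonneg (add_nonneg (mul_nonneg (hZq ρ hρ) (hg2nn ρ hρ)) (mul_nonneg (hSq ρ hρ) (hg1 ρ hρ))) (hDq ρ hρ)))
  have step1 : xβ * (N0 + β * (D2all - T)) * omH ≤ xβ * ((1 - β) * T) * omH := by
    have := mul_le_mul_of_nonneg_left hii (mul_nonneg hxβ0 homH0)
    have e1 : xβ * omH * (N0 + β * (D2all - T)) = xβ * (N0 + β * (D2all - T)) * omH := by ring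
    have e2 : xβ * omH * ((1 - β) * T) = xβ * ((1 - β) * T) * omH := by ring
    linarith
  have step3 : T * (xβ * (1 - β) * omH) ≤ T * ((1 - xβ) * (Dn0 + β * (omH - Zall))) :=
    mul_le_mul_of_nonneg_left hi hT0'
  have e3 : xβ * ((1 - β) * T) * omH = T * (xβ * (1 - β) * omH) := by ring
  have e4 : T * ((1 - xβ) * (Dn0 + β * (omH - Zall))) = (1 - xβ) * (Dn0 + β * (omH - Zall)) * T := by ring
  linarith [step1, step3]

/-- **(C1) for every boost `b ∈ [0, β]`** (memo §3): `x_β·(N₀ + b·ā)·(1 − H) ≤ (1 − x_β)·(Dn₀ + b·c̄)·T` with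
`ā = D2all − T`, `c̄ = (1 − H) − Zall`; both sides are affine in `b`, and the endpoints are `ratio_V1` (`b = 0`) and
`ratio_boost` (`b = β`). [this work] -/
theorem ratio_C1
    (hP : ∀ ρ ∈ S, 0 ≤ P ρ) (hsum : ∑ ρ ∈ S, P ρ = 1 - β) (hβ0 : 0 ≤ β) (hβ1 : β ≤ 1)
    (hA0 : 0 ≤ A1) (hA1 : A1 ≤ 1) (hu0 : 0 ≤ u1) (hu1 : u1 ≤ 1) (huz : u1 + z1 = 1)
    (hZq : ∀ ρ ∈ S, 0 ≤ Zq ρ) (hSq : ∀ ρ ∈ S, 0 ≤ Sq ρ) (hDq : ∀ ρ ∈ S, 0 ≤ Dq ρ) (hg1 : ∀ ρ ∈ S, 0 ≤ g1 ρ)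
    (hg2nn : ∀ ρ ∈ S, 0 ≤ g2 ρ) (hZF : ∀ ρ ∈ S, 0 ≤ ZF ρ) (hDF : ∀ ρ ∈ S, 0 ≤ DF ρ)
    (hx : ∀ ρ ∈ S, A1 * u1 ≤ g1 ρ) (hgU : ∀ ρ ∈ S, g1 ρ ≤ A1 * (1 - ZF ρ)) (hg2 : ∀ ρ ∈ S, g2 ρ ≤ A1 * DF ρ)
    (hZFz : ∀ ρ ∈ S, ZF ρ ≤ z1) (hZall : ∀ ρ ∈ S, Zall = Zq ρ * ZF ρ)
    (hD : ∀ ρ ∈ S, D2all = Dq ρ + Sq ρ * (1 - ZF ρ) + Zq ρ * DF ρ) (hZall0 : 0 ≤ Zall) (hD0 : 0 ≤ D2all) (N0 Dn0 omH T : ℝ)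
    (hN0 : N0 = ∑ ρ ∈ S, P ρ * (Zq ρ * g2 ρ + Sq ρ * g1 ρ)) (hDn0 : Dn0 = ∑ ρ ∈ S, P ρ * (Zq ρ * g1 ρ))
    (homH : omH = β * Zall + ∑ ρ ∈ S, P ρ * (Zq ρ * (1 - g1 ρ)))
    (hT : T = β * D2all + ∑ ρ ∈ S, P ρ * (Zq ρ * g2 ρ + Sq ρ * g1 ρ + Dq ρ))
    (bb : ℝ) (hb0 : 0 ≤ bb) (hbβ : bb ≤ β) :
    (β + (1 - β) * A1) * u1 * (N0 + bb * (D2all - T)) * omH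
      ≤ (1 - (β + (1 - β) * A1) * u1) * (Dn0 + bb * (omH - Zall)) * T := by
  have hg1le : ∀ ρ ∈ S, g1 ρ ≤ 1 := by
    intro ρ hρ; have h1 := hgU ρ hρ
    have : A1 * (1 - ZF ρ) ≤ 1 := by nlinarith [hZF ρ hρ, mul_nonneg hA0 (hZF ρ hρ)]
    linarith
  have h0 := ratio_V1 S P Zq Sq Dq g1 g2 ZF DF A1 u1 z1 β Zall D2all hP hsum hβ0 hA0 hA1 hu0 hu1 huz hZq hSq hDq hg1
    hg2nn hZF hDF hx hgU hg2 hZFz hZall hD N0 Dn0 omH T hN0 hDn0 homH hT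
  have h1 := ratio_boost S P Zq Sq Dq g1 g2 ZF A1 u1 z1 β Zall D2all hP hsum hβ0 hβ1 hA0 hA1 hu0 hu1 huz hZq hSq hDq
    hg1 hg1le hg2nn hx hZFz hZall hZall0 hD0 N0 Dn0 omH T hN0 hDn0 homH hT
  set xβ := (β + (1 - β) * A1) * u1 with hxβ
  -- affine interpolation: β·(LHS(b) − RHS(b)) = (β − b)(LHS(0) − RHS(0)) + b(LHS(β) − RHS(β))
  have hid : β * (xβ * (N0 + bb * (D2all - T)) * omH - (1 - xβ) * (Dn0 + bb * (omH - Zall)) * T)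
      = (β - bb) * (xβ * N0 * omH - (1 - xβ) * Dn0 * T)
        + bb * (xβ * (N0 + β * (D2all - T)) * omH - (1 - xβ) * (Dn0 + β * (omH - Zall)) * T) := by ring
  rcases eq_or_lt_of_le hβ0 with hβ | hβ
  · -- β = 0 ⟹ b = 0
    have hb : bb = 0 := le_antisymm (by rw [hβ]; exact hbβ) hb0
    rw [hb]; simp only [zero_mul, add_zero]; exact h0
  · have hneg : β * (xβ * (N0 + bb * (D2all - T)) * omH - (1 - xβ) * (Dn0 + bb * (omH - Zall)) * T) ≤ 0 := by
      rw [hid]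
      have t1 : (β - bb) * (xβ * N0 * omH - (1 - xβ) * Dn0 * T) ≤ 0 :=
        mul_nonpos_of_nonneg_of_nonpos (by linarith) (by linarith)
      have t2 : bb * (xβ * (N0 + β * (D2all - T)) * omH - (1 - xβ) * (Dn0 + β * (omH - Zall)) * T) ≤ 0 :=
        mul_nonpos_of_nonneg_of_nonpos hb0 (by linarith)
      linarith
    by_contra hcon
    have hcon' := not_le.mp hcon
    have : 0 < β * (xβ * (N0 + bb * (D2all - T)) * omH - (1 - xβ) * (Dn0 + bb * (omH - Zall)) * T) :=
      mul_pos hβ (by linarith)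
    linarith

/-- **(C) — the hypothesis of `Block.dominates_hubStep`.**  For every exit value `q ≤ x_β` (`x_β = m₁u₁` of the first hub
of the added arm; in the k-anchor programme `q = min_{i} m_iu_i ≤ m₁u₁`), every boost `b ∈ [0, β]` and every factor
`κ ≥ 0` (`κ = 1 − A_0`): with `π = κ·(N₀ + b·(D2all − T))` and `σ = κ·(Dn₀ + b·((1 − H) − Zall))`,
`π·q·(1 − H) ≤ σ·T·(1 − q)`. [this work] -/
theorem ratio_C
    (hP : ∀ ρ ∈ S, 0 ≤ P ρ) (hsum : ∑ ρ ∈ S, P ρ = 1 - β) (hβ0 : 0 ≤ β) (hβ1 : β ≤ 1)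
    (hA0 : 0 ≤ A1) (hA1 : A1 ≤ 1) (hu0 : 0 ≤ u1) (hu1 : u1 ≤ 1) (huz : u1 + z1 = 1)
    (hZq : ∀ ρ ∈ S, 0 ≤ Zq ρ) (hSq : ∀ ρ ∈ S, 0 ≤ Sq ρ) (hDq : ∀ ρ ∈ S, 0 ≤ Dq ρ) (hg1 : ∀ ρ ∈ S, 0 ≤ g1 ρ)
    (hg2nn : ∀ ρ ∈ S, 0 ≤ g2 ρ) (hZF : ∀ ρ ∈ S, 0 ≤ ZF ρ) (hDF : ∀ ρ ∈ S, 0 ≤ DF ρ)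
    (hx : ∀ ρ ∈ S, A1 * u1 ≤ g1 ρ) (hgU : ∀ ρ ∈ S, g1 ρ ≤ A1 * (1 - ZF ρ)) (hg2 : ∀ ρ ∈ S, g2 ρ ≤ A1 * DF ρ)
    (hZFz : ∀ ρ ∈ S, ZF ρ ≤ z1) (hZall : ∀ ρ ∈ S, Zall = Zq ρ * ZF ρ)
    (hD : ∀ ρ ∈ S, D2all = Dq ρ + Sq ρ * (1 - ZF ρ) + Zq ρ * DF ρ) (hZall0 : 0 ≤ Zall) (hD0 : 0 ≤ D2all) (N0 Dn0 omH T : ℝ)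
    (hN0 : N0 = ∑ ρ ∈ S, P ρ * (Zq ρ * g2 ρ + Sq ρ * g1 ρ)) (hDn0 : Dn0 = ∑ ρ ∈ S, P ρ * (Zq ρ * g1 ρ))
    (homH : omH = β * Zall + ∑ ρ ∈ S, P ρ * (Zq ρ * (1 - g1 ρ)))
    (hT : T = β * D2all + ∑ ρ ∈ S, P ρ * (Zq ρ * g2 ρ + Sq ρ * g1 ρ + Dq ρ))
    (bb : ℝ) (hb0 : 0 ≤ bb) (hbβ : bb ≤ β)
    (q κ : ℝ) (hq : q ≤ (β + (1 - β) * A1) * u1) (hκ : 0 ≤ κ) :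
    (κ * (N0 + bb * (D2all - T))) * q * omH ≤ (κ * (Dn0 + bb * (omH - Zall))) * T * (1 - q) := by
  have hC1 := ratio_C1 S P Zq Sq Dq g1 g2 ZF DF A1 u1 z1 β Zall D2all hP hsum hβ0 hβ1 hA0 hA1 hu0 hu1 huz hZq hSq hDq hg1
    hg2nn hZF hDF hx hgU hg2 hZFz hZall hD hZall0 hD0 N0 Dn0 omH T hN0 hDn0 homH hT bb hb0 hbβ
  set xβ := (β + (1 - β) * A1) * u1 with hxβ
  have hg1le : ∀ ρ ∈ S, g1 ρ ≤ 1 - ZF ρ := by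
    intro ρ hρ; have h1 := hgU ρ hρ
    have : A1 * (1 - ZF ρ) ≤ 1 - ZF ρ := by
      have h0 : 0 ≤ 1 - ZF ρ := by linarith [hZFz ρ hρ, show z1 ≤ 1 by linarith]
      nlinarith [mul_nonneg (sub_nonneg.mpr hA1) h0]
    linarith
  have hg2le : ∀ ρ ∈ S, g2 ρ ≤ DF ρ := by
    intro ρ hρ; have h1 := hg2 ρ hρ; nlinarith [hDF ρ hρ, mul_nonneg (sub_nonneg.mpr hA1) (hDF ρ hρ)]
  -- signs: N0 ≥ 0, D2all − T ≥ 0, omH ≥ 0, Dn0 ≥ 0, omH − Zall ≥ 0, T ≥ 0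
  have hN00 : 0 ≤ N0 := by
    rw [hN0]; exact Finset.sum_nonneg (fun ρ hρ => mul_nonneg (hP ρ hρ)
      (add_nonneg (mul_nonneg (hZq ρ hρ) (hg2nn ρ hρ)) (mul_nonneg (hSq ρ hρ) (hg1 ρ hρ))))
  have hDn00 : 0 ≤ Dn0 := by
    rw [hDn0]; exact Finset.sum_nonneg (fun ρ hρ => mul_nonneg (hP ρ hρ) (mul_nonneg (hZq ρ hρ) (hg1 ρ hρ)))
  have homH0 : 0 ≤ omH := by
    rw [homH]; apply add_nonneg (mul_nonneg hβ0 hZall0)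
    exact Finset.sum_nonneg (fun ρ hρ => mul_nonneg (hP ρ hρ) (mul_nonneg (hZq ρ hρ)
      (by linarith [hg1le ρ hρ, hZF ρ hρ])))
  have hT0' : 0 ≤ T := by
    rw [hT]; apply add_nonneg (mul_nonneg hβ0 hD0)
    exact Finset.sum_nonneg (fun ρ hρ => mul_nonneg (hP ρ hρ)
      (add_nonneg (add_nonneg (mul_nonneg (hZq ρ hρ) (hg2nn ρ hρ)) (mul_nonneg (hSq ρ hρ) (hg1 ρ hρ))) (hDq ρ hρ)))
  have hab : 0 ≤ D2all - T := by
    -- T = β D2all + Σ P d ≤ β D2all + Σ P D2all = D2all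
    have hle : ∑ ρ ∈ S, P ρ * (Zq ρ * g2 ρ + Sq ρ * g1 ρ + Dq ρ) ≤ ∑ ρ ∈ S, P ρ * D2all := by
      apply Finset.sum_le_sum; intro ρ hρ
      apply mul_le_mul_of_nonneg_left _ (hP ρ hρ)
      rw [hD ρ hρ]
      have t1 : Zq ρ * g2 ρ ≤ Zq ρ * DF ρ := mul_le_mul_of_nonneg_left (hg2le ρ hρ) (hZq ρ hρ)
      have t2 : Sq ρ * g1 ρ ≤ Sq ρ * (1 - ZF ρ) := mul_le_mul_of_nonneg_left (hg1le ρ hρ) (hSq ρ hρ)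
      linarith
    have e : ∑ ρ ∈ S, P ρ * D2all = (1 - β) * D2all := by rw [← Finset.sum_mul, hsum]
    rw [hT]; linarith
  have hcb : 0 ≤ omH - Zall := by
    -- omH − Zall = Σ P Zq (1 − g1) − (1−β) Zall = Σ P (Zq(1 − g1) − Zq ZF) ≥ 0
    have hle : ∑ ρ ∈ S, P ρ * Zall ≤ ∑ ρ ∈ S, P ρ * (Zq ρ * (1 - g1 ρ)) := by
      apply Finset.sum_le_sum; intro ρ hρ
      apply mul_le_mul_of_nonneg_left _ (hP ρ hρ)
      rw [hZall ρ hρ]; exact mul_le_mul_of_nonneg_left (by linarith [hg1le ρ hρ]) (hZq ρ hρ)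
    have e : ∑ ρ ∈ S, P ρ * Zall = (1 - β) * Zall := by rw [← Finset.sum_mul, hsum]
    rw [homH]; linarith
  -- monotonicity in q, then scale by κ
  have hK1 : 0 ≤ (N0 + bb * (D2all - T)) * omH := mul_nonneg (add_nonneg hN00 (mul_nonneg hb0 hab)) homH0
  have hK2 : 0 ≤ (Dn0 + bb * (omH - Zall)) * T := mul_nonneg (add_nonneg hDn00 (mul_nonneg hb0 hcb)) hT0'
  have m1 : q * ((N0 + bb * (D2all - T)) * omH) ≤ xβ * ((N0 + bb * (D2all - T)) * omH) :=
    mul_le_mul_of_nonneg_right hq hK1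
  have m2 : (1 - xβ) * ((Dn0 + bb * (omH - Zall)) * T) ≤ (1 - q) * ((Dn0 + bb * (omH - Zall)) * T) :=
    mul_le_mul_of_nonneg_right (by linarith) hK2
  have hmid : q * ((N0 + bb * (D2all - T)) * omH) ≤ (1 - q) * ((Dn0 + bb * (omH - Zall)) * T) := by
    have h' : xβ * (N0 + bb * (D2all - T)) * omH ≤ (1 - xβ) * (Dn0 + bb * (omH - Zall)) * T := hC1
    have e1 : xβ * (N0 + bb * (D2all - T)) * omH = xβ * ((N0 + bb * (D2all - T)) * omH) := by ring
    have e2 : (1 - xβ) * (Dn0 + bb * (omH - Zall)) * T = (1 - xβ) * ((Dn0 + bb * (omH - Zall)) * T) := by ring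
    linarith
  have hfinal := mul_le_mul_of_nonneg_left hmid hκ
  have e3 : κ * (q * ((N0 + bb * (D2all - T)) * omH)) = (κ * (N0 + bb * (D2all - T))) * q * omH := by ring
  have e4 : κ * ((1 - q) * ((Dn0 + bb * (omH - Zall)) * T)) = (κ * (Dn0 + bb * (omH - Zall))) * T * (1 - q) := by ring
  linarith

end Sums

end Block

end Quant

end Summit.CriticalPhenomena.PercolationContinuityZ3.Theorems

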